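import Summits.BirchSwinnertonDyer.BirchSwinnertonDyer.Theorems.SchneiderFreeAdditiveX3AnticycControlAdditiveTorsionCount
import HarnessLib

/-!
# Crux `AnticycControlAdditive` (route `SchneiderFreeAdditiveX3`, item stmt-BirchSwinnertonDyer-19178):
# T-B6-2′ and the crux BY NAME from the torsion-robust atoms

Seat `bsd-schneider-door-c4` (cell `bsd-schneider-ideate`). Companion of
`…AnticycControlAdditiveTorsionCount.lean` (the exact counting snake lemma
`#Sel^γ · #ker res = #Sel_𝔭(K) · #ker r_𝔭 · ∏_{Σ(N⁺)} #ker r_w`). Here: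

* **`additiveControlOnTreeAt_of_torsAtoms`** — T-B6-2′ (`SchneiderFree.AdditiveControlOnTreeAt`) at an
  additive `p` split in `K`, at ANY frame (no hypothesis on `E(K_𝔭)[p]` or `E(K)[p]`), from: the
  count, (KER-res) `#ker res = p^g`, (KER-𝔭) `#ker r_𝔭 = p^t`, the TORSION-AWARE base count
  (P6-add-tors) `a = ord_p #Ш + 2(ord_p log_ω P − ord_p idx) + ord_p ∏_{w∣p} c_w + g − t` (JSW17
  Prop. 3.2.1 read with Castella's convention at `𝔭̄`), (P9-𝓒) Poitou–Tate surjectivity, (L10) and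
  (P11): the exponents `g` and `t` CANCEL — the typed equality has no slack and no torsion term. With
  `g = t = 0` this is the count of the BC5 rung `additiveControlOnTreeAt_of_atoms`.
* **`anticycControlAdditive_of_torsAtoms`** — the route decl `AnticycControlAdditive` BY NAME from the
  atoms quantified over the B6 data (both registered stubs of the BC3 skeleton `4a862010…` at once).

CONDITIONAL on the atoms (hypotheses on cardinalities of tree objects: Poitou–Tate for `E[p^∞]`
over `K`, Kodaira–Néron at the additive `p`, Néron component groups at `w ∈ Σ(N⁺)`, Fin_v); no `Prop`
fact minted; closes nothing by itself; BSD is not proved by any of this. Derivation memo (why `g` and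
`t` cancel; printed template Keller–Yin arXiv:2402.12781 App. B Thm. B.0.6): evidence
`CONTROL-DERIVATION.md` on the crux item.

References: [JetchevSkinnerWan2017] §3.2–3.3 (arXiv:1512.06894 pp. 10–14); [Castella2018] Thm. 2.3;
[GreenbergLNM1716] §3 pp. 85–90.
-/

noncomputable section

open scoped Classical

open WeierstrassCurve NumberField IsDedekindDomain Field Literature.NumberTheory.EllipticCurves
  Literature.NumberTheory.EllipticCurves.ModularForms
  Literature.NumberTheory.EllipticCurves.GreenbergSelmer
  Literature.NumberTheory.GaloisRepresentations
  Literature.NumberTheory.EllipticCurves.Rank1Residual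
  Literature.NumberTheory.EllipticCurves.Rank1Residual.Typed
  Summit.BirchSwinnertonDyer.Rank1Residual
  Summit.BirchSwinnertonDyer.Rank1Residual.X11b
  Summit.BirchSwinnertonDyer.Rank1Residual.X11b.AcSelmer
  Summit.BirchSwinnertonDyer.BirchSwinnertonDyer.Theorems.SchneiderFree
  Summit.BirchSwinnertonDyer.BirchSwinnertonDyer.Theorems.SchneiderFreeControlAtoms

set_option linter.dupNamespace false

namespace Summit.BirchSwinnertonDyer.BirchSwinnertonDyer.Theorems.SchneiderFreeAdditiveX3

section Anticyclotomic

variable {W : WeierstrassCurve ℚ} [W.IsElliptic] [W.IsGloballyMinimal] {K : Type} [Field K]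
  [NumberField K] {p : ℕ} [Fact p.Prime] {κ : ZpExtension K p}

/-- **T-B6-2′ FROM THE TORSION-ROBUST ATOMS (the `t_p = 1` analogue of the BC5 rung; kernel-checked
glue).** For `K` imaginary quadratic with `p` split and `p ∣ N_E` (additive `p`), an anticyclotomic
`κ` with topological generator `γ`, a prime `𝔭 ∣ p`, any `ι`, `P`, and natural numbers `g, t, a`:
IF (KER-res) `#ker(H¹(K, E[p^∞]) → H¹(K_∞, E[p^∞])) = p^g`, (KER-𝔭) `#ker r_𝔭 = p^t`, (P6-add-tors)
Castella's Selmer group over `K` has order `p^a` with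
`a = ord_p #Ш(E/K)[p^∞] + 2(ord_p log_ω P − ord_p[E(K):ℤP]) + ord_p ∏_{w∣p} c_w(E/K) + g − t`,
(P9-𝓒) the Poitou–Tate surjectivity `hloc`, (L10) `CoinvariantsTrivialAt` and (P11) `LocalKernelOrderAt`
at every `w ∈ Σ(N⁺)`, THEN `AdditiveControlOnTreeAt p κ 𝔭 γ ι P`: the exponents `g` (global
`p`-torsion, `#E(K)[p^∞]`) and `t` (local, `#E(K_𝔭)[p^∞]`) CANCEL. With `g = t = 0` this is the
count of `additiveControlOnTreeAt_of_atoms`. [cite: JetchevSkinnerWan2017, Thm. 3.3.1 and Prop. 3.2.1 (arXiv:1512.06894 pp. 10–11)]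
[cite: Castella2018, Thm. 2.3 (arXiv:1704.06608 p. 5)] -/
theorem additiveControlOnTreeAt_of_torsAtoms (hK : IsImaginaryQuadratic K) (hsplit : SplitsIn K p)
    (hpN : p ∣ W.conductorNorm ℤ) (hκ : κ.IsAnticyclotomic)
    (γ : absoluteGaloisGroup K) [hγ : Fact (κ.IsTopGenerator γ)] (𝔭 : HeightOneSpectrum (𝓞 K))
    (h𝔭 : ((p : ℕ) : 𝓞 K) ∈ 𝔭.asIdeal) (ι : K →+* ℚ_[p]) (P : (W.baseChange K).toAffine.Point)
    (g t a : ℕ)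
    (hres : Nat.card ((W.baseChange K).resOfLe p (le_top : κ.kerSubgroup ≤ ⊤)).ker = p ^ g)
    (h𝔭ker : Nat.card (localKer κ.kerSubgroup ((W.baseChange K).geomPrimaryTorsion p) 𝔭) = p ^ t)
    (h6 : (∃ _ : Finite (selmerAcBase (W.baseChange K) p 𝔭 ∅),
        Nat.card (selmerAcBase (W.baseChange K) p 𝔭 ∅) = p ^ a) ∧
      (a : ℤ) = (padicValNat p
          (Nat.card (AddCommGroup.primaryComponent (W.baseChange K).sha p)) : ℤ) +
        2 * (X11b.padicLogOrd W p ι P - (padicValNat p (AddSubgroup.zmultiples P).index : ℤ)) +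
          padicValNat p (X11b.tamagawaProductAbove W K p) + g - t)
    (hloc : ∀ x : Π v : ↥(insert 𝔭 (nPlusPlaces_finite (W := W) (p := p) (K := K) hK.1).toFinset),
        Literature.NumberTheory.EllipticCurves.subgroupH1
          ((⊤ : Subgroup (absoluteGaloisGroup K)) ⊓ decomp (v : HeightOneSpectrum (𝓞 K)))
          ((W.baseChange K).geomPrimaryTorsion p),
      (∀ v : ↥(insert 𝔭 (nPlusPlaces_finite (W := W) (p := p) (K := K) hK.1).toFinset),
        x v ∈ localKer κ.kerSubgroup ((W.baseChange K).geomPrimaryTorsion p)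
          (v : HeightOneSpectrum (𝓞 K))) →
        ∃ c : (W.baseChange K).subgroupH1 p (⊤ : Subgroup (absoluteGaloisGroup K)),
          locAtFinset (W.baseChange K) p _ c = x ∧
          ∀ v : HeightOneSpectrum (𝓞 K), ((p : ℕ) : 𝓞 K) ∉ v.asIdeal → v ∉ (∅ : Set _) →
            v ∉ insert 𝔭 (nPlusPlaces_finite (W := W) (p := p) (K := K) hK.1).toFinset →
              c ∈ awayKer ⊤ ((W.baseChange K).geomPrimaryTorsion p) v)
    (h10 : X11b.CoinvariantsTrivialAt (W.baseChange K) p κ 𝔭 γ)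
    (h11 : ∀ v ∈ nPlusPlaces W K p, X11b.LocalKernelOrderAt (W.baseChange K) p κ v) :
    AdditiveControlOnTreeAt p κ 𝔭 γ ι P := by
  have hp : p.Prime := Fact.out
  haveI : IsTotallyComplex K := hK.2
  obtain ⟨⟨hfinK, hcardK⟩, ha⟩ := h6
  haveI := hfinK
  have hfin𝔭 : Finite (localKer κ.kerSubgroup ((W.baseChange K).geomPrimaryTorsion p) 𝔭) :=
    Nat.finite_of_card_ne_zero (by rw [h𝔭ker]; exact pow_ne_zero _ hp.ne_zero)
  have hfin : ∀ v ∈ nPlusPlaces W K p,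
      Finite (localKer κ.kerSubgroup ((W.baseChange K).geomPrimaryTorsion p) v) :=
    fun v hv ↦ (h11 v hv).1
  obtain ⟨hfinγ, _, hcount⟩ := natCard_endInvariants_mul_natCard_resKer_eq_nPlus (W := W) hK hκ γ 𝔭
    h𝔭 hfin𝔭 hfin hloc
  -- the local kernels at `Σ(N⁺)` are the Tamagawa `p`-parts
  have hprod : (∏ v ∈ (nPlusPlaces_finite (W := W) (p := p) (K := K) hK.1).toFinset,
      Nat.card (localKer κ.kerSubgroup ((W.baseChange K).geomPrimaryTorsion p) v)) =
        p ^ ∑ v ∈ (nPlusPlaces_finite (W := W) (p := p) (K := K) hK.1).toFinset, padicValNat p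
          (((W.baseChange K).baseChange (v.adicCompletion K)).localTamagawaNumber
            (v.adicCompletionIntegers K)) := by
    rw [← Finset.prod_pow_eq_pow_sum]
    refine Finset.prod_congr rfl fun v hv => ?_
    obtain ⟨_, hv'⟩ := h11 v ((nPlusPlaces_finite (W := W) (p := p) hK.1).mem_toFinset.mp hv)
    exact hv'
  rw [hres, hcardK, h𝔭ker, hprod, ← pow_add, ← pow_add] at hcount
  -- `#Sel^γ · p^g = p^m`, `m = a + (t + Σ ord_p c_w)`, hence `#Sel^γ = p^(m - g)`
  obtain ⟨m, hm, hcount⟩ : ∃ m : ℕ, m = a + (t + ∑ v ∈ (nPlusPlaces_finite (W := W) (p := p)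
      (K := K) hK.1).toFinset, padicValNat p
        (((W.baseChange K).baseChange (v.adicCompletion K)).localTamagawaNumber
          (v.adicCompletionIntegers K))) ∧
      Nat.card (IwasawaDual.endInvariants (conjSelmerAc (W.baseChange K) p κ 𝔭 ∅ γ - 1)) * p ^ g =
        p ^ m := ⟨_, rfl, hcount⟩
  have hle : g ≤ m := by
    have hdvd : p ^ g ∣ p ^ m := ⟨_, by rw [mul_comm]; exact hcount.symm⟩
    exact (Nat.pow_dvd_pow_iff_le_right hp.one_lt).mp hdvd
  have hcardγ : Nat.card (IwasawaDual.endInvariants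
      (conjSelmerAc (W.baseChange K) p κ 𝔭 ∅ γ - 1)) = p ^ (m - g) := by
    have hsplitpow : p ^ m = p ^ (m - g) * p ^ g := by
      rw [← pow_add, Nat.sub_add_cancel hle]
    rw [hsplitpow] at hcount
    exact Nat.eq_of_mul_eq_mul_right (pow_pos hp.pos g) hcount
  have hcoinv := X11b.natCard_endCoinvariants_eq_one_of_surjective _ h10
  rw [additiveControlOnTreeAt_iff_card p κ 𝔭 γ ι P]
  refine ⟨m - g, ⟨hfinγ, ?_⟩, ?_⟩
  · rw [hcardγ, hcoinv, mul_one]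
  · rw [Nat.cast_sub hle, hm, Nat.cast_add, Nat.cast_add, ha,
      X11b.padicValNat_tamagawaProductSplit_eq_above_add_sum W p hK.1 hsplit hpN]
    push_cast
    ring

end Anticyclotomic

/-! ## Class level: the crux `AnticycControlAdditive` CLOSED MODULO the torsion-robust atoms -/

section ClassLevel

open Summit.BirchSwinnertonDyer.BirchSwinnertonDyer.Theses.SchneiderFreeAdditiveX3

/-- **The crux `AnticycControlAdditive` from the torsion-robust atoms (class level; both stubs at
once).** IF at every B6 Heegner datum and every anticyclotomic frame `(κ, γ, 𝔭)` there are exponents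
`g, t, a` with (KER-res) `#ker res = p^g`, (KER-𝔭) `#ker r_𝔭 = p^t`, (P6-add-tors) `#Sel_𝔭(K, E[p^∞]) = p^a`,
`a = ord_p #Ш + 2(ord_p log_ω P − ord_p idx) + ord_p ∏_{w∣p} c_w + g − t`, (P9-𝓒) the Poitou–Tate
surjectivity and (L10) `CoinvariantsTrivialAt`, and IF (P11) `X11b.R1LocalKernelOrderAt` holds on the
additive locus, THEN the route decl `AnticycControlAdditive` holds. NO case split on `E(K_𝔭)[p]`:
the count `additiveControlOnTreeAt_of_torsAtoms` is uniform in `t_p ∈ {0, 1}`. CONDITIONAL on the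
atoms (Poitou–Tate for `E[p^∞]` over `K`, Kodaira–Néron at the additive `p`, Néron component groups
at `w ∈ Σ(N⁺)`, Fin_v); closes nothing by itself.
[cite: JetchevSkinnerWan2017, Thm. 3.3.1, Prop. 3.2.1, Prop. 3.3.2, Lemma 3.3.3, Prop. 3.3.4 (arXiv:1512.06894 pp. 10–13)]
[cite: Castella2018, Thm. 2.3 (arXiv:1704.06608 p. 5)] -/
theorem anticycControlAdditive_of_torsAtoms
    (hAt : ∀ (W : WeierstrassCurve ℚ) [W.IsElliptic] [W.IsGloballyMinimal] (p : ℕ) [Fact p.Prime],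
      W.analyticRank = 1 → p ≠ 2 → ClassX3 W p → Additive.SubSemistableTwist W p →
      ∀ (N : ℕ) [NeZero N] (K : Type) [Field K] [NumberField K]
        (Dt : ModularParametrizationData W N) (H : HeegnerDatum N (NumberField.discr K)) (ι : K →+* ℂ)
        (P : (W.baseChange K).toAffine.Point),
        W.analyticRank = 1 → Additive.N10.Locus W p → W.conductorNorm ℤ = N →
        ∀ hK : IsImaginaryQuadratic K,
        Odd (NumberField.discr K) → ¬ p ∣ Units.torsionOrder K → SatisfiesHeegnerHypothesis N K →
        (W.quadraticTwist (NumberField.discr K : ℚ)).entireLFunction 1 ≠ 0 →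
        WeierstrassCurve.Affine.Point.map ι.toRatAlgHom P = heegnerPointComplex Dt H →
        ¬ IsOfFinAddOrder P →
        ∀ (κ : ZpExtension K p), κ.IsAnticyclotomic →
          ∀ (γ : Field.absoluteGaloisGroup K) [Fact (κ.IsTopGenerator γ)]
            (𝔭 : HeightOneSpectrum (𝓞 K)) (h𝔭 : ((p : ℕ) : 𝓞 K) ∈ 𝔭.asIdeal)
            (he : 𝔭.asIdeal.ramificationIdx (𝓞 ℚ) = 1) (hf : 𝔭.asIdeal.inertiaDeg (𝓞 ℚ) = 1),
            ∃ g t a : ℕ,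
              Nat.card ((W.baseChange K).resOfLe p (le_top : κ.kerSubgroup ≤ ⊤)).ker = p ^ g ∧
              Nat.card (localKer κ.kerSubgroup ((W.baseChange K).geomPrimaryTorsion p) 𝔭) = p ^ t ∧
              ((∃ _ : Finite (selmerAcBase (W.baseChange K) p 𝔭 ∅),
                  Nat.card (selmerAcBase (W.baseChange K) p 𝔭 ∅) = p ^ a) ∧
                (a : ℤ) = (padicValNat p
                    (Nat.card (AddCommGroup.primaryComponent (W.baseChange K).sha p)) : ℤ) +
                  2 * (X11b.padicLogOrd W p (embAt K p 𝔭 h𝔭 he hf) P -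
                    (padicValNat p (AddSubgroup.zmultiples P).index : ℤ)) +
                    padicValNat p (X11b.tamagawaProductAbove W K p) + g - t) ∧
              (∀ x : Π v : ↥(insert 𝔭 (nPlusPlaces_finite (W := W) (p := p) (K := K) hK.1).toFinset),
                  Literature.NumberTheory.EllipticCurves.subgroupH1
                    ((⊤ : Subgroup (absoluteGaloisGroup K)) ⊓ decomp (v : HeightOneSpectrum (𝓞 K)))
                    ((W.baseChange K).geomPrimaryTorsion p),
                (∀ v : ↥(insert 𝔭 (nPlusPlaces_finite (W := W) (p := p) (K := K) hK.1).toFinset),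
                  x v ∈ localKer κ.kerSubgroup ((W.baseChange K).geomPrimaryTorsion p)
                    (v : HeightOneSpectrum (𝓞 K))) →
                  ∃ c : (W.baseChange K).subgroupH1 p (⊤ : Subgroup (absoluteGaloisGroup K)),
                    locAtFinset (W.baseChange K) p _ c = x ∧
                    ∀ v : HeightOneSpectrum (𝓞 K), ((p : ℕ) : 𝓞 K) ∉ v.asIdeal → v ∉ (∅ : Set _) →
                      v ∉ insert 𝔭 (nPlusPlaces_finite (W := W) (p := p) (K := K) hK.1).toFinset →
                        c ∈ awayKer ⊤ ((W.baseChange K).geomPrimaryTorsion p) v) ∧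
              X11b.CoinvariantsTrivialAt (W.baseChange K) p κ 𝔭 γ)
    (hL : ∀ (W : WeierstrassCurve ℚ) [W.IsElliptic] [W.IsGloballyMinimal] (p : ℕ) [Fact p.Prime],
      Additive.N10.Locus W p → X11b.R1LocalKernelOrderAt W p) :
    AnticycControlAdditive := by
  intro W _ _ p _ hr hp2 hX hS N _ K _ _ Dt H ι P hr' hloc hN hK hodd hunit hHe hL1 hP hnt κ hκ γ _ 𝔭
    h𝔭 he hf
  have hpN : p ∣ W.conductorNorm ℤ := dvd_conductorNorm_of_n10Locus hloc
  have hsplit : SplitsIn K p := splitsIn_of_satisfiesHeegnerHypothesis hN hHe hpN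
  obtain ⟨g, t, a, hres, h𝔭ker, h6, hl, h10⟩ :=
    hAt W p hr hp2 hX hS N K Dt H ι P hr' hloc hN hK hodd hunit hHe hL1 hP hnt κ hκ γ 𝔭 h𝔭 he hf
  exact additiveControlOnTreeAt_of_torsAtoms (W := W) hK hsplit hpN hκ γ 𝔭 h𝔭 (embAt K p 𝔭 h𝔭 he hf)
    P g t a hres h𝔭ker h6 hl h10 (hL W p hloc K hK κ hκ)

/-- **The registered stub `stub_control_localPTorsion` (BC3 skeleton `4a862010…`, the `t_p = 1` half)
CLOSED MODULO the torsion-robust atoms**: its signature verbatim (the hypothesis `E(K_𝔭)[p] ≠ 0` is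
not even used — the count is uniform in `t_p`), from `anticycControlAdditive_of_torsAtoms`.
[cite: JetchevSkinnerWan2017, Thm. 3.3.1 (arXiv:1512.06894 p. 11)] -/
theorem stub_control_localPTorsion_of_torsAtoms
    (hAt : ∀ (W : WeierstrassCurve ℚ) [W.IsElliptic] [W.IsGloballyMinimal] (p : ℕ) [Fact p.Prime],
      W.analyticRank = 1 → p ≠ 2 → ClassX3 W p → Additive.SubSemistableTwist W p →
      ∀ (N : ℕ) [NeZero N] (K : Type) [Field K] [NumberField K]
        (Dt : ModularParametrizationData W N) (H : HeegnerDatum N (NumberField.discr K)) (ι : K →+* ℂ)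
        (P : (W.baseChange K).toAffine.Point),
        W.analyticRank = 1 → Additive.N10.Locus W p → W.conductorNorm ℤ = N →
        ∀ hK : IsImaginaryQuadratic K,
        Odd (NumberField.discr K) → ¬ p ∣ Units.torsionOrder K → SatisfiesHeegnerHypothesis N K →
        (W.quadraticTwist (NumberField.discr K : ℚ)).entireLFunction 1 ≠ 0 →
        WeierstrassCurve.Affine.Point.map ι.toRatAlgHom P = heegnerPointComplex Dt H →
        ¬ IsOfFinAddOrder P →
        ∀ (κ : ZpExtension K p), κ.IsAnticyclotomic →
          ∀ (γ : Field.absoluteGaloisGroup K) [Fact (κ.IsTopGenerator γ)]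
            (𝔭 : HeightOneSpectrum (𝓞 K)) (h𝔭 : ((p : ℕ) : 𝓞 K) ∈ 𝔭.asIdeal)
            (he : 𝔭.asIdeal.ramificationIdx (𝓞 ℚ) = 1) (hf : 𝔭.asIdeal.inertiaDeg (𝓞 ℚ) = 1),
            ∃ g t a : ℕ,
              Nat.card ((W.baseChange K).resOfLe p (le_top : κ.kerSubgroup ≤ ⊤)).ker = p ^ g ∧
              Nat.card (localKer κ.kerSubgroup ((W.baseChange K).geomPrimaryTorsion p) 𝔭) = p ^ t ∧
              ((∃ _ : Finite (selmerAcBase (W.baseChange K) p 𝔭 ∅),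
                  Nat.card (selmerAcBase (W.baseChange K) p 𝔭 ∅) = p ^ a) ∧
                (a : ℤ) = (padicValNat p
                    (Nat.card (AddCommGroup.primaryComponent (W.baseChange K).sha p)) : ℤ) +
                  2 * (X11b.padicLogOrd W p (embAt K p 𝔭 h𝔭 he hf) P -
                    (padicValNat p (AddSubgroup.zmultiples P).index : ℤ)) +
                    padicValNat p (X11b.tamagawaProductAbove W K p) + g - t) ∧
              (∀ x : Π v : ↥(insert 𝔭 (nPlusPlaces_finite (W := W) (p := p) (K := K) hK.1).toFinset),
                  Literature.NumberTheory.EllipticCurves.subgroupH1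
                    ((⊤ : Subgroup (absoluteGaloisGroup K)) ⊓ decomp (v : HeightOneSpectrum (𝓞 K)))
                    ((W.baseChange K).geomPrimaryTorsion p),
                (∀ v : ↥(insert 𝔭 (nPlusPlaces_finite (W := W) (p := p) (K := K) hK.1).toFinset),
                  x v ∈ localKer κ.kerSubgroup ((W.baseChange K).geomPrimaryTorsion p)
                    (v : HeightOneSpectrum (𝓞 K))) →
                  ∃ c : (W.baseChange K).subgroupH1 p (⊤ : Subgroup (absoluteGaloisGroup K)),
                    locAtFinset (W.baseChange K) p _ c = x ∧
                    ∀ v : HeightOneSpectrum (𝓞 K), ((p : ℕ) : 𝓞 K) ∉ v.asIdeal → v ∉ (∅ : Set _) →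
                      v ∉ insert 𝔭 (nPlusPlaces_finite (W := W) (p := p) (K := K) hK.1).toFinset →
                        c ∈ awayKer ⊤ ((W.baseChange K).geomPrimaryTorsion p) v) ∧
              X11b.CoinvariantsTrivialAt (W.baseChange K) p κ 𝔭 γ)
    (hL : ∀ (W : WeierstrassCurve ℚ) [W.IsElliptic] [W.IsGloballyMinimal] (p : ℕ) [Fact p.Prime],
      Additive.N10.Locus W p → X11b.R1LocalKernelOrderAt W p) :
    ∀ (W : WeierstrassCurve ℚ) [W.IsElliptic] [W.IsGloballyMinimal] (p : ℕ) [Fact p.Prime],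
      W.analyticRank = 1 → p ≠ 2 → ClassX3 W p → Additive.SubSemistableTwist W p →
      ∀ (N : ℕ) [NeZero N] (K : Type) [Field K] [NumberField K]
        (Dt : ModularParametrizationData W N) (H : HeegnerDatum N (NumberField.discr K)) (ι : K →+* ℂ)
        (P : (W.baseChange K).toAffine.Point),
        W.analyticRank = 1 → Additive.N10.Locus W p → W.conductorNorm ℤ = N → IsImaginaryQuadratic K →
        Odd (NumberField.discr K) → ¬ p ∣ Units.torsionOrder K → SatisfiesHeegnerHypothesis N K →
        (W.quadraticTwist (NumberField.discr K : ℚ)).entireLFunction 1 ≠ 0 →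
        WeierstrassCurve.Affine.Point.map ι.toRatAlgHom P = heegnerPointComplex Dt H →
        ¬ IsOfFinAddOrder P →
        ∀ (κ : ZpExtension K p), κ.IsAnticyclotomic →
          ∀ (γ : Field.absoluteGaloisGroup K) [Fact (κ.IsTopGenerator γ)]
            (𝔭 : HeightOneSpectrum (𝓞 K)) (h𝔭 : ((p : ℕ) : 𝓞 K) ∈ 𝔭.asIdeal)
            (he : 𝔭.asIdeal.ramificationIdx (𝓞 ℚ) = 1) (hf : 𝔭.asIdeal.inertiaDeg (𝓞 ℚ) = 1),
            ¬ (∀ m : (W.baseChange K).geomPrimaryTorsion p,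
              (∀ d ∈ decomp 𝔭, d • m = m) → p • m = 0 → m = 0) →
            AdditiveControlOnTreeAt p κ 𝔭 γ (embAt K p 𝔭 h𝔭 he hf) P := by
  intro W _ _ p _ hr hp2 hX hS N _ K _ _ Dt H ι P hr' hloc hN hK hodd hunit hHe hL1 hP hnt κ hκ γ _ 𝔭
    h𝔭 he hf _
  exact anticycControlAdditive_of_torsAtoms hAt hL W p hr hp2 hX hS N K Dt H ι P hr' hloc hN hK hodd
    hunit hHe hL1 hP hnt κ hκ γ 𝔭 h𝔭 he hf

end ClassLevel

end Summit.BirchSwinnertonDyer.BirchSwinnertonDyer.Theorems.SchneiderFreeAdditiveX3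

end
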